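import Literature.Topology.FourManifolds.TimeDependentFlow
import Literature.Topology.FourManifolds.ClosedBall
import HarnessLib

/-!
# Rigid collar coordinates, flows I: velocity fields of smooth families and local actions;
# the rotation of the circle; the radial model flow of the fold

Auxiliary file for the sub-bricks `helper_collar_flowV`, `helper_collar_flowW` (layer (F) "flows"
of the registered stub `helper_sliceGluing_rigidCollar`, apex brick F2-collar), line `Sketch`,
crux `SblfDescent.RungOne`.

(Crux item stmt-SmoothPoincare4-18531; skeleton `Cruxes/RungOne/Lines/Sketch.lean`.)

Generic differential-topology plumbing, SBLF-independent:

* `famVel A q` — the velocity `∂A/∂t (t, x)` of a family `A : ℝ × P → P` at `q = (t, x)`, as the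
  differential of `A` applied to `(1, 0)`; smooth as a map into `TP` over `A` on any open set on
  which `A` is `C^∞` (`contMDiffOn_famVel`, Hirsch 1976, Ch. 8 §1: the field of tangent vectors
  to the track curves), and the curves `t ↦ A (t, x)` have derivative `famVel A (t, x)`
  (`hasMFDerivAt_famCurve`).
* `actVel A x = famVel A (0, x)` — the **generator of a local action**: when `A (0, x) = x` on an
  open set `T` the section `x ↦ actVel A x` of `TP` is `C^∞` on `T` (`contMDiffOn_actVel`), and a
  curve `t ↦ A (t, x)` satisfying the local group law `A (τ, x) = A (τ - s, A (s, x))` near `τ = s`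
  has derivative `actVel A (A (s, x))` at `s` (`hasMFDerivAt_act_of_law`) — so it is an integral
  curve of any vector field extending `actVel A` (Lee 2013, Prop. 9.7 / Thm. 20.18: the
  infinitesimal generator of a flow).
* `rotS t` — the rotation of the unit circle `𝕊¹ ⊆ ℝ²` by the angle `t`, jointly smooth, a
  one-parameter group.
* `radE t` — the radial model flow `(ξ₀, ξ₁, ξ₂) ↦ (c ξ₀, c ξ₁, ξ₂)`, `c = √(m + t)/√m`,
  `m = ξ₀² + ξ₁²`, on `ℝ³` off the `ξ₂`-axis: the lift of `∂/∂s` through the fold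
  `Q = ξ₀² + ξ₁² - ξ₂²` (`QE`) preserving the height `ξ₂` and the angle, a local one-parameter
  group moving `Q`, `m` (`mE`) and `|ξ|²` at unit speed.

Everything here is proved; the `def`s are explicit; no named fact is introduced.

## References

* M. W. Hirsch, *Differential Topology*, GTM 33 (1976), Ch. 8 §1, p. 178. [HirschDT1976]
* J. M. Lee, *Introduction to Smooth Manifolds*, 2nd ed. (2013), Prop. 9.7, Thm. 9.12.
  [LeeSmoothManifolds2013]
-/

set_option linter.dupNamespace false

noncomputable section

open scoped Manifold ContDiff Topology RealInnerProductSpace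
open Set Function Bundle Literature.Topology.FourManifolds

namespace Summit.SmoothPoincare4.SmoothPoincare4.Cruxes.RungOne.Sketch

/-- Local notation: `𝔼 n` is the model Euclidean space `EuclideanSpace ℝ (Fin n)`. -/
local notation "𝔼 " n:arg => EuclideanSpace ℝ (Fin n)

attribute [local instance] Literature.Topology.FourManifolds.fact_finrank_euclideanSpace_succ

/-! ### Velocities of smooth families `A : ℝ × P → P` -/

section Velocity

-- the tangent spaces of `ℝ × P` and `P` are the model spaces `ℝ × E`, `E` by definition, which
-- the derivative lemmas of this section must see through
set_option backward.isDefEq.respectTransparency false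

variable {E : Type*} [NormedAddCommGroup E] [NormedSpace ℝ E] {H : Type*} [TopologicalSpace H]
  {I : ModelWithCorners ℝ E H} {P : Type*} [TopologicalSpace P] [ChartedSpace H P]

/-- **The velocity of a family** `A : ℝ × P → P` at `q = (t, x)`: the differential of `A` at `q`
applied to the unit time vector `(1, 0) ∈ T_q(ℝ × P) = ℝ × E`; an element of
`T_{A q} P = E` (Hirsch 1976, Ch. 8 §1, p. 178). [cite: HirschDT1976, Ch. 8 §1, p. 178] -/
def famVel (A : ℝ × P → P) (q : ℝ × P) : TangentSpace I (A q) :=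
  mfderiv (𝓘(ℝ, ℝ).prod I) I A q (((1 : ℝ), (0 : E)) : TangentSpace (𝓘(ℝ, ℝ).prod I) q)

/-- **The generator of a local action**: the velocity at time `0`, `actVel A x = ∂A/∂t (0, x)`,
read as a tangent vector at `x` (meaningful where `A (0, x) = x`). [cite: LeeSmoothManifolds2013, Prop. 9.7] -/
def actVel (A : ℝ × P → P) (x : P) : TangentSpace I x :=
  famVel (I := I) A ((0 : ℝ), x)

variable [IsManifold I ∞ P]

/-- The constant section `(1, 0)` of `T(ℝ × P)` is smooth (the suspension of the zero field,
`contMDiff_suspension`). [folklore] -/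
theorem contMDiff_unitTimeSection :
    ContMDiff (𝓘(ℝ, ℝ).prod I) (𝓘(ℝ, ℝ).prod I).tangent ∞
      fun q : ℝ × P => (⟨q, (((1 : ℝ), (0 : E)) : TangentSpace (𝓘(ℝ, ℝ).prod I) q)⟩ :
        TangentBundle (𝓘(ℝ, ℝ).prod I) (ℝ × P)) :=
  contMDiff_suspension ((Bundle.contMDiff_zeroSection ℝ (TangentSpace I : P → Type _)).comp
    contMDiff_snd)

/-- **The velocity field of a smooth family is smooth** as a map into `TP` over `A`, on any open
set `O` on which `A` is `C^∞`: it is the tangent map of `A` (within `O`) composed with the smooth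
section `(1, 0)` of `T(ℝ × P)` (Hirsch 1976, Ch. 8 §1, p. 178; cf. the tree's
`SmoothIsotopy.contMDiff_velocity`). [cite: HirschDT1976, Ch. 8 §1, p. 178] -/
theorem contMDiffOn_famVel {A : ℝ × P → P} {O : Set (ℝ × P)} (hO : IsOpen O)
    (hA : ContMDiffOn (𝓘(ℝ, ℝ).prod I) I ∞ A O) :
    ContMDiffOn (𝓘(ℝ, ℝ).prod I) I.tangent ∞
      (fun q : ℝ × P => (⟨A q, famVel (I := I) A q⟩ : TangentBundle I P)) O := by
  have hT : ContMDiffOn (𝓘(ℝ, ℝ).prod I).tangent I.tangent ∞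
      (tangentMapWithin (𝓘(ℝ, ℝ).prod I) I A O)
      (π (ℝ × E) (TangentSpace (𝓘(ℝ, ℝ).prod I)) ⁻¹' O) :=
    hA.contMDiffOn_tangentMapWithin (m := ∞) (by norm_cast) hO.uniqueMDiffOn
  have hS := (contMDiff_unitTimeSection (I := I) (P := P)).contMDiffOn (s := O)
  have hcomp := hT.comp hS fun q hq => by simpa using hq
  refine hcomp.congr fun q hq => ?_
  simp only [comp_apply, famVel]
  rw [tangentMapWithin, mfderivWithin_of_isOpen hO hq]

omit [IsManifold I ∞ P] in
/-- **The curves `t ↦ A (t, x)` are tangent to the velocity**: for `(t, x) ∈ O` the curve has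
derivative `famVel A (t, x)` at `t` (chain rule for `A ∘ (t ↦ (t, x))`; Hirsch 1976, Ch. 8 §1,
p. 178). [cite: HirschDT1976, Ch. 8 §1, p. 178] -/
theorem hasMFDerivAt_famCurve {A : ℝ × P → P} {O : Set (ℝ × P)} (hO : IsOpen O)
    (hA : ContMDiffOn (𝓘(ℝ, ℝ).prod I) I ∞ A O) {t : ℝ} {x : P} (hq : (t, x) ∈ O) :
    HasMFDerivAt 𝓘(ℝ, ℝ) I (fun s : ℝ => A (s, x)) t
      ((1 : ℝ →L[ℝ] ℝ).smulRight (famVel (I := I) A (t, x))) := by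
  have hAd : MDifferentiableAt (𝓘(ℝ, ℝ).prod I) I A (t, x) :=
    (hA.contMDiffAt (hO.mem_nhds hq)).mdifferentiableAt (by simp)
  have hι : HasMFDerivAt 𝓘(ℝ, ℝ) (𝓘(ℝ, ℝ).prod I) (fun r : ℝ => ((r, x) : ℝ × P)) t
      ((ContinuousLinearMap.id ℝ ℝ).prod (0 : ℝ →L[ℝ] TangentSpace I x)) :=
    (hasMFDerivAt_id t).prodMk (hasMFDerivAt_const x t)
  have h := hAd.hasMFDerivAt.comp t hι
  refine h.congr_mfderiv (ContinuousLinearMap.ext_ring ?_)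
  change mfderiv (𝓘(ℝ, ℝ).prod I) I A (t, x) (((1 : ℝ), (0 : E)) :
      TangentSpace (𝓘(ℝ, ℝ).prod I) (t, x)) = (1 : ℝ) • famVel (I := I) A (t, x)
  rw [one_smul]
  rfl

omit [IsManifold I ∞ P] in
/-- Two points of the total space of the tangent bundle with equal base points and equal vector
parts (elements of the model space `E`) are equal. [folklore] -/
theorem tangentBundle_mk_eq {x y : P} (h : x = y) (w : E) :
    (⟨x, w⟩ : TangentBundle I P) = ⟨y, w⟩ := by
  subst h; rfl

/-- **The generator of a local action is a smooth vector field**: if `A` is `C^∞` on an open set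
`O ⊇ {0} × T` and `A (0, x) = x` for `x ∈ T`, then `x ↦ actVel A x` is a `C^∞` section of `TP`
on `T` (Lee 2013, Prop. 9.7). [cite: LeeSmoothManifolds2013, Prop. 9.7] -/
theorem contMDiffOn_actVel {A : ℝ × P → P} {O : Set (ℝ × P)} (hO : IsOpen O)
    (hA : ContMDiffOn (𝓘(ℝ, ℝ).prod I) I ∞ A O) {T : Set P}
    (h0 : ∀ x ∈ T, ((0 : ℝ), x) ∈ O) (hfix : ∀ x ∈ T, A (0, x) = x) :
    ContMDiffOn I I.tangent ∞
      (fun x : P => (⟨x, actVel (I := I) A x⟩ : TangentBundle I P)) T := by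
  have hι : ContMDiff I (𝓘(ℝ, ℝ).prod I) ∞ fun x : P => (((0 : ℝ), x) : ℝ × P) :=
    contMDiff_const.prodMk contMDiff_id
  have h := (contMDiffOn_famVel hO hA).comp hι.contMDiffOn fun x hx => h0 x hx
  refine h.congr fun x hx => ?_
  simp only [comp_apply, actVel]
  exact tangentBundle_mk_eq (hfix x hx).symm _

omit [IsManifold I ∞ P] in
/-- **Curves of a local action are integral curves of its generator**: if near `τ = s` the curve
`τ ↦ A (τ, x)` is the time-shifted curve through `y = A (s, x)`, `A (τ, x) = A (τ - s, y)`, and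
`(0, y) ∈ O`, then `τ ↦ A (τ, x)` has derivative `actVel A y` at `s` (Lee 2013, Prop. 9.7 /
Thm. 9.12: `θ^{(p)}` is an integral curve of the infinitesimal generator).
[cite: LeeSmoothManifolds2013, Prop. 9.7] -/
theorem hasMFDerivAt_act_of_law {A : ℝ × P → P} {O : Set (ℝ × P)} (hO : IsOpen O)
    (hA : ContMDiffOn (𝓘(ℝ, ℝ).prod I) I ∞ A O) {s : ℝ} {x : P}
    (hy : ((0 : ℝ), A (s, x)) ∈ O)
    (hlaw : ∀ᶠ τ in 𝓝 s, A (τ, x) = A (τ - s, A (s, x))) :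
    HasMFDerivAt 𝓘(ℝ, ℝ) I (fun τ : ℝ => A (τ, x)) s
      ((1 : ℝ →L[ℝ] ℝ).smulRight (actVel (I := I) A (A (s, x)))) := by
  have h0 : HasMFDerivAt 𝓘(ℝ, ℝ) I (fun τ : ℝ => A (τ, A (s, x))) (s - s)
      ((1 : ℝ →L[ℝ] ℝ).smulRight (actVel (I := I) A (A (s, x)))) := by
    rw [sub_self]
    exact hasMFDerivAt_famCurve hO hA hy
  have hsh : HasMFDerivAt 𝓘(ℝ, ℝ) 𝓘(ℝ, ℝ) (fun τ : ℝ => τ - s) s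
      (ContinuousLinearMap.id ℝ ℝ) := by
    have h := (hasMFDerivAt_id (I := 𝓘(ℝ, ℝ)) s).sub (hasMFDerivAt_const (I := 𝓘(ℝ, ℝ))
      (I' := 𝓘(ℝ, ℝ)) s s)
    refine h.congr_mfderiv ?_
    rw [sub_zero]
    rfl
  have hc := HasMFDerivAt.comp s (f := fun τ : ℝ => τ - s) h0 hsh
  have hc' : HasMFDerivAt 𝓘(ℝ, ℝ) I (fun τ : ℝ => A (τ - s, A (s, x))) s
      ((1 : ℝ →L[ℝ] ℝ).smulRight (actVel (I := I) A (A (s, x)))) := by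
    exact hc.congr_mfderiv (ContinuousLinearMap.ext_ring rfl)
  exact hc'.congr_of_eventuallyEq hlaw

end Velocity

/-! ### The rotation of the unit circle -/

section Rotation

/-- The planar rotation by the angle `t`, as a map of `ℝ²`. [folklore] -/
def rotE (t : ℝ) (p : 𝔼 2) : 𝔼 2 :=
  !₂[Real.cos t * p 0 - Real.sin t * p 1, Real.sin t * p 0 + Real.cos t * p 1]

/-- Coordinates of the planar rotation. [folklore] -/
@[simp] theorem rotE_apply_zero (t : ℝ) (p : 𝔼 2) :
    rotE t p 0 = Real.cos t * p 0 - Real.sin t * p 1 := by simp [rotE]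

/-- Coordinates of the planar rotation. [folklore] -/
@[simp] theorem rotE_apply_one (t : ℝ) (p : 𝔼 2) :
    rotE t p 1 = Real.sin t * p 0 + Real.cos t * p 1 := by simp [rotE]

/-- The planar rotation preserves the norm. [folklore] -/
theorem norm_rotE (t : ℝ) (p : 𝔼 2) : ‖rotE t p‖ = ‖p‖ := by
  have h : ‖rotE t p‖ ^ 2 = ‖p‖ ^ 2 := by
    rw [EuclideanSpace.norm_sq_eq, EuclideanSpace.norm_sq_eq, Fin.sum_univ_two, Fin.sum_univ_two]
    simp only [Real.norm_eq_abs, sq_abs, rotE_apply_zero, rotE_apply_one]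
    nlinarith [Real.sin_sq_add_cos_sq t]
  exact (sq_eq_sq₀ (norm_nonneg _) (norm_nonneg _)).1 h

/-- The planar rotation is jointly smooth in the angle and the point. [folklore] -/
theorem contDiff_rotE : ContDiff ℝ ∞ fun q : ℝ × 𝔼 2 => rotE q.1 q.2 := by
  rw [contDiff_euclidean]
  have h0 : ContDiff ℝ ∞ fun q : ℝ × 𝔼 2 => q.2 0 := contDiff_euclidean.1 contDiff_snd 0
  have h1 : ContDiff ℝ ∞ fun q : ℝ × 𝔼 2 => q.2 1 := contDiff_euclidean.1 contDiff_snd 1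
  have hc : ContDiff ℝ ∞ fun q : ℝ × 𝔼 2 => Real.cos q.1 := Real.contDiff_cos.comp contDiff_fst
  have hs : ContDiff ℝ ∞ fun q : ℝ × 𝔼 2 => Real.sin q.1 := Real.contDiff_sin.comp contDiff_fst
  intro i
  fin_cases i
  · simp only [Fin.zero_eta, Fin.isValue, rotE_apply_zero]
    exact (hc.mul h0).sub (hs.mul h1)
  · simp only [Fin.mk_one, Fin.isValue, rotE_apply_one]
    exact (hs.mul h0).add (hc.mul h1)

/-- Rotating by `0` is the identity. [folklore] -/
@[simp] theorem rotE_zero (p : 𝔼 2) : rotE 0 p = p := by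
  ext i; fin_cases i <;> simp

/-- Rotations compose by adding the angles. [folklore] -/
theorem rotE_add (t s : ℝ) (p : 𝔼 2) : rotE (t + s) p = rotE t (rotE s p) := by
  ext i
  fin_cases i
  · simp only [Fin.zero_eta, Fin.isValue, rotE_apply_zero, rotE_apply_one, Real.cos_add,
      Real.sin_add]
    ring
  · simp only [Fin.mk_one, Fin.isValue, rotE_apply_one, rotE_apply_zero, Real.cos_add,
      Real.sin_add]
    ring

/-- **The rotation of the unit circle** `𝕊¹ ⊆ ℝ²` by the angle `t`. [folklore] -/
def rotS (t : ℝ) (u : Metric.sphere (0 : 𝔼 2) 1) : Metric.sphere (0 : 𝔼 2) 1 :=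
  ⟨rotE t u, by rw [mem_sphere_zero_iff_norm, norm_rotE, norm_eq_of_mem_sphere u]⟩

/-- The rotated point, as a vector. [folklore] -/
@[simp] theorem coe_rotS (t : ℝ) (u : Metric.sphere (0 : 𝔼 2) 1) :
    ((rotS t u : Metric.sphere (0 : 𝔼 2) 1) : 𝔼 2) = rotE t u := rfl

/-- Rotating the circle by `0` is the identity. [folklore] -/
@[simp] theorem rotS_zero (u : Metric.sphere (0 : 𝔼 2) 1) : rotS 0 u = u :=
  Subtype.ext (rotE_zero _)

/-- Rotating by a full turn is the identity. [folklore] -/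
@[simp] theorem rotE_two_pi (p : 𝔼 2) : rotE (2 * Real.pi) p = p := by
  ext i; fin_cases i <;> simp

/-- Rotating the circle by a full turn is the identity. [folklore] -/
@[simp] theorem rotS_two_pi (u : Metric.sphere (0 : 𝔼 2) 1) : rotS (2 * Real.pi) u = u :=
  Subtype.ext (rotE_two_pi _)

/-- **One-parameter group law** of the rotations of the circle. [folklore] -/
theorem rotS_add (t s : ℝ) (u : Metric.sphere (0 : 𝔼 2) 1) : rotS (t + s) u = rotS t (rotS s u) :=
  Subtype.ext (rotE_add _ _ _)

/-- Smooth maps composed into the planar rotation are smooth (the term is elaborated before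
being matched against the goal, lest the unifier unfold the trigonometric functions). [folklore] -/
theorem contMDiff_rotE_comp {EM : Type*} [NormedAddCommGroup EM] [NormedSpace ℝ EM]
    {HM : Type*} [TopologicalSpace HM] {IM : ModelWithCorners ℝ EM HM} {M : Type*}
    [TopologicalSpace M] [ChartedSpace HM M] {f : M → ℝ} {g : M → 𝔼 2}
    (hf : ContMDiff IM 𝓘(ℝ, ℝ) ∞ f) (hg : ContMDiff IM 𝓘(ℝ, 𝔼 2) ∞ g) :
    ContMDiff IM 𝓘(ℝ, 𝔼 2) ∞ fun x => rotE (f x) (g x) :=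
  (contDiff_rotE.comp_contMDiff (hf.prodMk_space hg) :)

/-- `rotS (-t)` undoes `rotS t`. [folklore] -/
@[simp] theorem rotS_neg_rotS (t : ℝ) (u : Metric.sphere (0 : 𝔼 2) 1) : rotS (-t) (rotS t u) = u := by
  rw [← rotS_add, neg_add_cancel, rotS_zero]

/-- **The rotation of the circle is jointly smooth** in the angle and the point
(`ContMDiff.codRestrict_sphere`). [folklore] -/
theorem contMDiff_rotS :
    ContMDiff (𝓘(ℝ, ℝ).prod (𝓡 1)) (𝓡 1) ∞
      fun q : ℝ × Metric.sphere (0 : 𝔼 2) 1 => rotS q.1 q.2 := by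
  have h2 : ContMDiff (𝓘(ℝ, ℝ).prod (𝓡 1)) 𝓘(ℝ, 𝔼 2) ∞
      fun q : ℝ × Metric.sphere (0 : 𝔼 2) 1 => (q.2 : 𝔼 2) :=
    contMDiff_coe_sphere.comp contMDiff_snd
  exact (contMDiff_rotE_comp contMDiff_fst h2).codRestrict_sphere fun q => (rotS q.1 q.2).2

end Rotation

/-! ### The radial model flow on `ℝ³` -/

section Radial

/-- `m ξ = ξ₀² + ξ₁²`, the squared distance from the `x₂`-axis. [folklore] -/
def mE (ξ : 𝔼 3) : ℝ := ξ 0 ^ 2 + ξ 1 ^ 2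

/-- The quadratic form `Q ξ = ξ₀² + ξ₁² - ξ₂²` of the fold. [folklore] -/
def QE (ξ : 𝔼 3) : ℝ := ξ 0 ^ 2 + ξ 1 ^ 2 - ξ 2 ^ 2

/-- **The radial model flow** `radE t ξ = (c ξ₀, c ξ₁, ξ₂)`, `c = √(m + t)/√m`, `m = ξ₀² + ξ₁²`:
it preserves the angle `β` and the height `ξ₂` of `ξ` and moves `Q` (and `m`, and `|ξ|²`) at
unit speed — the lift of `∂/∂s` along which the annuli `{Q = s}` keep their parametrisation
`(ξ₂, β)`. [folklore] -/
def radE (t : ℝ) (ξ : 𝔼 3) : 𝔼 3 :=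
  !₂[√(mE ξ + t) / √(mE ξ) * ξ 0, √(mE ξ + t) / √(mE ξ) * ξ 1, ξ 2]

/-- Coordinates of the radial flow. [folklore] -/
@[simp] theorem radE_apply_zero (t : ℝ) (ξ : 𝔼 3) :
    radE t ξ 0 = √(mE ξ + t) / √(mE ξ) * ξ 0 := by simp [radE]

/-- Coordinates of the radial flow. [folklore] -/
@[simp] theorem radE_apply_one (t : ℝ) (ξ : 𝔼 3) :
    radE t ξ 1 = √(mE ξ + t) / √(mE ξ) * ξ 1 := by simp [radE]

/-- The radial flow preserves the height `ξ₂`. [folklore] -/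
@[simp] theorem radE_apply_two (t : ℝ) (ξ : 𝔼 3) : radE t ξ 2 = ξ 2 := by simp [radE]

/-- The radial flow moves `m` at unit speed: `m (radE t ξ) = m ξ + t` (`m ξ > 0`, `m ξ + t ≥ 0`).
[folklore] -/
theorem mE_radE {t : ℝ} {ξ : 𝔼 3} (hm : 0 < mE ξ) (ht : 0 ≤ mE ξ + t) :
    mE (radE t ξ) = mE ξ + t := by
  have h1 : mE (radE t ξ) = (√(mE ξ + t) / √(mE ξ)) ^ 2 * mE ξ := by
    simp only [mE, radE_apply_zero, radE_apply_one]; ring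
  rw [h1, div_pow, Real.sq_sqrt ht, Real.sq_sqrt hm.le, div_mul_cancel₀ _ hm.ne']

/-- The radial flow moves `Q` at unit speed. [folklore] -/
theorem QE_radE {t : ℝ} {ξ : 𝔼 3} (hm : 0 < mE ξ) (ht : 0 ≤ mE ξ + t) :
    QE (radE t ξ) = QE ξ + t := by
  have h := mE_radE hm ht
  simp only [mE] at h
  simp only [QE, radE_apply_two]
  linarith

/-- `‖ξ‖² = m ξ + ξ₂²` on `ℝ³`. [folklore] -/
theorem norm_sq_eq_mE (ξ : 𝔼 3) : ‖ξ‖ ^ 2 = mE ξ + ξ 2 ^ 2 := by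
  rw [EuclideanSpace.norm_sq_eq, Fin.sum_univ_three]
  simp [Real.norm_eq_abs, sq_abs, mE]

/-- The radial flow moves `‖ξ‖²` at unit speed. [folklore] -/
theorem norm_sq_radE {t : ℝ} {ξ : 𝔼 3} (hm : 0 < mE ξ) (ht : 0 ≤ mE ξ + t) :
    ‖radE t ξ‖ ^ 2 = ‖ξ‖ ^ 2 + t := by
  rw [norm_sq_eq_mE, norm_sq_eq_mE, mE_radE hm ht, radE_apply_two]; ring

/-- At time `0` the radial flow is the identity (off the axis). [folklore] -/
theorem radE_zero {ξ : 𝔼 3} (hm : 0 < mE ξ) : radE 0 ξ = ξ := by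
  have hc : √(mE ξ) / √(mE ξ) = 1 := div_self (Real.sqrt_ne_zero'.2 hm)
  ext i
  fin_cases i <;> simp [hc]

/-- **Local group law** of the radial flow. [folklore] -/
theorem radE_add {t s : ℝ} {ξ : 𝔼 3} (hm : 0 < mE ξ) (hs : 0 < mE ξ + s) :
    radE (t + s) ξ = radE t (radE s ξ) := by
  have hm' : mE (radE s ξ) = mE ξ + s := mE_radE hm hs.le
  have hc : √(mE ξ + s + t) / √(mE ξ + s) * (√(mE ξ + s) / √(mE ξ)) =
      √(mE ξ + (t + s)) / √(mE ξ) := by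
    rw [div_mul_div_comm, mul_comm (√(mE ξ + s)) (√(mE ξ)), ← div_mul_div_comm,
      div_self (Real.sqrt_ne_zero'.2 hs), mul_one, show mE ξ + s + t = mE ξ + (t + s) by ring]
  ext i
  fin_cases i
  · simp only [Fin.zero_eta, Fin.isValue, radE_apply_zero, hm']
    rw [← mul_assoc, hc]
  · simp only [Fin.mk_one, Fin.isValue, radE_apply_one, hm']
    rw [← mul_assoc, hc]
  · simp

/-- `m` is smooth. [folklore] -/
theorem contDiff_mE : ContDiff ℝ ∞ mE := by unfold mE; fun_prop

/-- `Q` is smooth. [folklore] -/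
theorem contDiff_QE : ContDiff ℝ ∞ QE := by unfold QE; fun_prop

/-- **The radial flow is smooth** on the open set `{m ξ > 0, m ξ + t > 0}`. [folklore] -/
theorem contDiffOn_radE :
    ContDiffOn ℝ ∞ (fun q : ℝ × 𝔼 3 => radE q.1 q.2) {q | 0 < mE q.2 ∧ 0 < mE q.2 + q.1} := by
  have hm : ContDiff ℝ ∞ fun q : ℝ × 𝔼 3 => mE q.2 := contDiff_mE.comp contDiff_snd
  have hc : ContDiffOn ℝ ∞ (fun q : ℝ × 𝔼 3 => √(mE q.2 + q.1) / √(mE q.2))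
      {q | 0 < mE q.2 ∧ 0 < mE q.2 + q.1} := by
    refine ContDiffOn.div ?_ ?_ fun q hq => Real.sqrt_ne_zero'.2 hq.1
    · exact ((hm.add contDiff_fst).contDiffOn).sqrt fun q hq => hq.2.ne'
    · exact hm.contDiffOn.sqrt fun q hq => hq.1.ne'
  have h0 : ContDiff ℝ ∞ fun q : ℝ × 𝔼 3 => q.2 0 := contDiff_euclidean.1 contDiff_snd 0
  have h1 : ContDiff ℝ ∞ fun q : ℝ × 𝔼 3 => q.2 1 := contDiff_euclidean.1 contDiff_snd 1
  have h2 : ContDiff ℝ ∞ fun q : ℝ × 𝔼 3 => q.2 2 := contDiff_euclidean.1 contDiff_snd 2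
  rw [contDiffOn_euclidean]
  intro i
  fin_cases i
  · simp only [Fin.zero_eta, Fin.isValue, radE_apply_zero]; exact hc.mul h0.contDiffOn
  · simp only [Fin.mk_one, Fin.isValue, radE_apply_one]; exact hc.mul h1.contDiffOn
  · simp only [Fin.reduceFinMk, radE_apply_two, Fin.isValue]; exact h2.contDiffOn

/-- The domain of the radial flow is open. [folklore] -/
theorem isOpen_radDomE : IsOpen {q : ℝ × 𝔼 3 | 0 < mE q.2 ∧ 0 < mE q.2 + q.1} :=
  (isOpen_lt continuous_const (contDiff_mE.continuous.comp continuous_snd)).inter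
    (isOpen_lt continuous_const
      ((contDiff_mE.continuous.comp continuous_snd).add continuous_fst))

end Radial


end Summit.SmoothPoincare4.SmoothPoincare4.Cruxes.RungOne.Sketch

end
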